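import Literature.NumberTheory.EllipticCurves.Rank1Residual.Predicates
import Literature.NumberTheory.EllipticCurves.SerreOpenImageNormalizerCaseProofs
import Literature.NumberTheory.EllipticCurves.SemistableModPImageAbelianProofs
import Literature.NumberTheory.EllipticCurves.NonEisensteinPrimeOfSurjective
import Literature.NumberTheory.GaloisRepresentations.CyclotomicLevels
import HarnessLib

/-!
# BSD rank-≤1 residual cell: `p` odd, `E[p]` irreducible ⇒ no point of order `p` over an
# ABELIAN extension of `ℚ` (`E(ℚ^{ab})[p^∞] = 0`)

HONEST FRAMING (cell `b2b-bsdres-*`, run/shared/lean/b2b/bsd-rank1-residual/, verbatim): the goal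
of the cell is to DELETE the COMBINATION-SHAPED residual classes for ALL analytic-rank `≤ 1` elliptic
curves over `ℚ` — "full BSD formula for every rank `≤ 1` curve in class C" assembled STRICTLY from
published theorems — so that the rank-`≤ 1` remainder becomes exactly the CONSTRUCTION-SHAPED
classes, which are TYPED (missing-input Props), NOT attempted; this is not "finishing BSD".
Prove what is provable now; shrink each hard class to its core with data; no claim beyond stated
classes.  Research routes; census output = EVIDENCE, never a Literature fact.  Unit
`b2b-bsdres-n1011-p11` (team n1011, ROUTE-1 sub-target R1-8 (i), OWNERS row **T-R18a**).
THEOREMS ONLY (no definition, no named fact, no instance); a TOOL file about the Galois module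
`E[p]` — no closure value, no class theorem, no label moves.

## What this file does

The kernel lemma asked for by ROUTE-1 §15.1 (i) / §15.4 R1-8 (i) ("F-d v2: IRREDUCIBILITY
SUFFICES"): for an elliptic curve `E = W/ℚ`, an ODD prime `p` with `E[p]` an irreducible
`Γ_ℚ`-module, no point of `E[p] ∖ 0` is fixed by the commutator subgroup `[Γ_ℚ, Γ_ℚ]`, i.e.
`E(ℚ^{ab})[p] = 0`: **no curve with `E[p]` irreducible has a point of order `p` over ANY abelian
extension `K/ℚ`, ramified at `p` or not.**  This removes the hypothesis "unramified at `p`" (hence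
semistability) from the use of Wuthrich 2014, Lemma 5 in the period-integrality step (ii) of F-d v2
(OWNERS row T-R18b), where `K = ℚ(ζ_N)` carries the cuspidal torsion points `φ₀((r) − (∞))`.

Proof (ROUTE-1 §15.1 (i); Serre 1972 §5.2 (iv) is the only arithmetic input): the subgroup
`H = E[p]^{[Γ,Γ]}` of points fixed by the (normal) commutator subgroup is `Γ_ℚ`-stable, hence `0`
or `E[p]` by irreducibility.  If it were `E[p]`, every commutator would act trivially, so the image
`G = ρ̄_{E,p}(Γ_ℚ) ⊆ GL₂(𝔽_p)` would be abelian; but `G` contains the image `c` of complex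
conjugation, `c² = 1`, `det c = χ̄_p(c) = −1` (the tree's `exists_conj_mem_map_range`, from the Weil
pairing and `exists_frame_galoisRepTorsion_rat`), and an abelian subgroup of `GL₂(𝔽_p)`, `p` odd,
containing such a `c` fixes a line (the tree's `Serre1972.exists_le_eigenvectorStabilizer_of_comm`:
the `1`-eigenline of `c`, the eigenvalues `1 ≠ −1` being distinct) — contradicting irreducibility
(`not_le_eigenvectorStabilizer_of_hasIrreducibleModPGaloisRep`).  So `H = 0`.  `p` odd is used
exactly once (`−1 ≠ 1` in `𝔽_p`); at `p = 2` the statement is false (image `C₃ ⊂ GL₂(𝔽₂)` is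
irreducible with `ℚ(E[2])` cyclic cubic).

* `geomTorsion_eq_zero_of_commutator_fixed_of_irreducible` — **the kernel lemma** in the exact
  shape proposed in ROUTE-1 §15.4: `P ∈ E[p]` fixed by `commutator Γ_ℚ` ⇒ `P = 0`.
* `geomTorsion_eq_zero_of_fixed_of_commutator_le` — the same for the fixed points of any subgroup
  `U ≤ Γ_ℚ` containing the commutator subgroup (the tree's idiom for "the fixed field of `U` is
  abelian over `ℚ`", cf. `EulerSystemLevels.commutator_le_pLevel`, `commutator_le_rootsOfUnityFixer`).
* `geomPoints_eq_zero_of_fixed_of_pow_smul_eq_zero`, `not_dvd_addOrderOf_of_fixed` —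
  `E(K)[p^∞] = 0` for such `U = Γ_K`: a `U`-fixed geometric point killed by `p^k` is `O`, and a
  `U`-fixed torsion point has order prime to `p` (the form F-d v2 (ii) consumes: "the order `m_r` of
  `Q_r ∈ E₀(ℚ(ζ_N))_tors` is prime to `p`").
* `geomPoints_eq_zero_of_rootsOfUnityFixer_fixed_of_pow_smul_eq_zero`,
  `not_dvd_addOrderOf_of_rootsOfUnityFixer_fixed` — the case `K = ℚ(μ_N) ⊆ \bar ℚ`
  (`U = rootsOfUnityFixer ℚ N = Gal(\bar ℚ/ℚ(μ_N))`, abelian by `commutator_le_rootsOfUnityFixer`).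
* `geomTorsion_eq_zero_of_commutator_fixed_of_surj` — the variant under `surj(p)` (`p` odd), via
  the tree's `hasIrreducibleModPGaloisRep_of_hasSurjectiveModNGaloisRep`; and the row readings
  `geomTorsion_eq_zero_of_commutator_fixed_of_classX4` / `not_dvd_addOrderOf_of_fixed_of_classX4`
  (class X4 = `p ≠ 2 ∧ add(p) ∧ irr(p)`: on EVERY X4 pair, whatever the reduction, `E(ℚ^{ab})[p^∞] = 0`).

What is NOT here: the isogeny-class clause of §15.1 (i) ("for every curve `E'` of the class") is
the same lemma applied to `E'` — irreducibility of `E'[p]` for `E'` isogenous to `E` is isogeny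
bookkeeping left to the consumer; nothing at `p = 2`; no statement about cusps, modular symbols or
periods (T-R18b); no class theorem.  Finite core for the `surj(p)` route (the two elementary
transvections have no common fixed vector), kernel-checked by the route planner, is
`cells/n1011/route1/R18_core.lean` — not needed here, the irreducible form being stronger at odd `p`.

## References

* [Serre1972] J.-P. Serre, *Propriétés galoisiennes des points d'ordre fini des courbes
  elliptiques*, Invent. Math. 15 (1972) 259–331: §5.2 (iv) (complex conjugation: eigenvalues
  `1, −1`), §5.4 (an abelian image containing `c` is Borel).
* [Wuthrich2014] C. Wuthrich, *On the integrality of modular symbols and Kato's Euler system for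
  elliptic curves*, Doc. Math. 19 (2014) 381–402: Lemma 5 (the semistable / unramified form this
  lemma replaces), Lemma 6 and proof of Thm 4 (the consumer, T-R18b).
* Cell files: `cells/n1011/ROUTE-1.md` §15.1 (i), §15.4 R1-8; `cells/n1011/PLAN.md` R4-4 (d).
-/

noncomputable section

open scoped Classical commutatorElement
open Field Matrix
open WeierstrassCurve Literature.NumberTheory.EllipticCurves Literature.NumberTheory.GaloisRepresentations
  Literature.NumberTheory.GaloisRepresentations.Serre1972
  Literature.NumberTheory.EllipticCurves.Rank1Residual

namespace Summit.BirchSwinnertonDyer.Rank1Residual.GaloisImage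

variable (W : WeierstrassCurve ℚ) [W.IsElliptic] (p : ℕ) [hp : Fact p.Prime]

/-! ### The kernel lemma: `E[p]^{[Γ_ℚ, Γ_ℚ]} = 0` for `p` odd, `E[p]` irreducible -/

/-- **`p` odd, `E[p]` irreducible ⇒ no non-zero `p`-torsion point is fixed by the commutator
subgroup of `Γ_ℚ`** (ROUTE-1 §15.1 (i) / R1-8 (i), the shape proposed in §15.4): for an elliptic
curve `E = W/ℚ`, an odd prime `p` with `E[p]` an irreducible `Γ_ℚ`-module, and `P ∈ E[p] = E(\bar ℚ)[p]`
with `σ P = P` for every `σ ∈ [Γ_ℚ, Γ_ℚ]`, we have `P = O`.  Equivalently `E(ℚ^{ab})[p] = 0`: no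
point of order `p` over any abelian extension of `ℚ`.  Proof: `H = E[p]^{[Γ,Γ]}` is a `Γ_ℚ`-stable
subgroup (the commutator subgroup is normal), so `H = 0` or `H = E[p]` (`HasIrreducibleModPGaloisRep`);
in the second case all commutators act trivially, the image `G ⊆ GL₂(𝔽_p)` of `Γ_ℚ` (in a frame,
`exists_frame_galoisRepTorsion_rat`) is abelian and contains complex conjugation `c` (`c² = 1`,
`det c = −1`, `exists_conj_mem_map_range`), hence fixes the `1`-eigenline of `c`
(`Serre1972.exists_le_eigenvectorStabilizer_of_comm`, `2 ≠ 0` in `𝔽_p`) — impossible for an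
irreducible `E[p]` (`not_le_eigenvectorStabilizer_of_hasIrreducibleModPGaloisRep`).
[cite: Serre1972, §5.2 (iv) and §5.4] -/
theorem geomTorsion_eq_zero_of_commutator_fixed_of_irreducible (hp2 : p ≠ 2)
    (hirr : W.HasIrreducibleModPGaloisRep p) (P : geomTorsion W p)
    (hP : ∀ σ ∈ commutator (absoluteGaloisGroup ℚ), σ • P = P) : P = 0 := by
  -- the subgroup of `E[p]` fixed pointwise by the commutator subgroup `[Γ_ℚ, Γ_ℚ]`
  let H : AddSubgroup (geomTorsion W p) :=
    { carrier := {Q | ∀ σ ∈ commutator (absoluteGaloisGroup ℚ), σ • Q = Q}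
      zero_mem' := fun σ _ ↦ smul_zero σ
      add_mem' := fun {a b} ha hb σ hσ ↦ by rw [smul_add, ha σ hσ, hb σ hσ]
      neg_mem' := fun {a} ha σ hσ ↦ by rw [smul_neg, ha σ hσ] }
  have hmem : ∀ Q : geomTorsion W p,
      Q ∈ H ↔ ∀ σ ∈ commutator (absoluteGaloisGroup ℚ), σ • Q = Q := fun Q ↦ Iff.rfl
  -- `H` is `Γ_ℚ`-stable because the commutator subgroup is normal
  have hstab : ∀ τ : absoluteGaloisGroup ℚ, ∀ Q ∈ H, τ • Q ∈ H := by
    intro τ Q hQ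
    rw [hmem] at hQ ⊢
    intro σ hσ
    have hconj : τ⁻¹ * σ * τ⁻¹⁻¹ ∈ commutator (absoluteGaloisGroup ℚ) :=
      (inferInstance : (commutator (absoluteGaloisGroup ℚ)).Normal).conj_mem σ hσ τ⁻¹
    rw [inv_inv] at hconj
    calc σ • τ • Q = τ • ((τ⁻¹ * σ * τ) • Q) := by rw [mul_smul, mul_smul, smul_inv_smul]
      _ = τ • Q := by rw [hQ _ hconj]
  rcases hirr H hstab with hbot | htop
  · -- `E[p]^{[Γ,Γ]} = 0`
    have hPH : P ∈ H := (hmem P).mpr hP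
    rwa [hbot, AddSubgroup.mem_bot] at hPH
  · -- `E[p]^{[Γ,Γ]} = E[p]`: the image `G` of `Γ_ℚ` is abelian and contains complex conjugation
    exfalso
    obtain ⟨e, Φ, he, -, -, -, -⟩ := exists_frame_galoisRepTorsion_rat W p
    set G : Subgroup (GL (Fin 2) (ZMod p)) :=
      (galoisRepTorsion W p).range.map Φ.toMonoidHom with hG
    -- every commutator of `Γ_ℚ` acts trivially on `E[p]`
    have htriv : ∀ σ τ : absoluteGaloisGroup ℚ, galoisRepTorsion W p ⁅σ, τ⁆ = 1 := by
      intro σ τ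
      have hστ : ⁅σ, τ⁆ ∈ commutator (absoluteGaloisGroup ℚ) := by
        rw [commutator_def]
        exact Subgroup.commutator_mem_commutator (Subgroup.mem_top σ) (Subgroup.mem_top τ)
      refine Multiplicative.toAdd.injective (AddEquiv.ext fun Q ↦ ?_)
      rw [galoisRepTorsion_apply]
      exact (hmem Q).mp (htop ▸ AddSubgroup.mem_top Q) _ hστ
    have hcomm : ∀ a ∈ G, ∀ b ∈ G, a * b = b * a := by
      intro a ha b hb
      obtain ⟨σ, rfl⟩ := (mem_map_range_galoisRepTorsion_iff W p Φ).mp ha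
      obtain ⟨τ, rfl⟩ := (mem_map_range_galoisRepTorsion_iff W p Φ).mp hb
      rw [← commutatorElement_eq_one_iff_mul_comm, ← map_commutatorElement,
        ← map_commutatorElement, htriv, map_one]
    obtain ⟨c, hcG, hc, hcdet⟩ := exists_conj_mem_map_range W p Φ e he
    have h2 : (2 : ZMod p) ≠ 0 := by
      intro h
      have h' : ((2 : ℕ) : ZMod p) = 0 := by exact_mod_cast h
      rw [ZMod.natCast_eq_zero_iff, Nat.prime_dvd_prime_iff_eq hp.out Nat.prime_two] at h'
      exact hp2 h'
    obtain ⟨v, hv, hle⟩ := exists_le_eigenvectorStabilizer_of_comm h2 hcomm hcG hc hcdet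
    exact not_le_eigenvectorStabilizer_of_hasIrreducibleModPGaloisRep W p Φ e he hirr hv hle

/-- **`E(K)[p] = 0` for `K/ℚ` abelian, subgroup form.**  For `p` odd with `E[p]` irreducible and
ANY subgroup `U ≤ Γ_ℚ` containing the commutator subgroup (i.e. `U = Gal(\bar ℚ/K)` with
`K ⊆ ℚ^{ab}`; the tree's idiom, cf. `commutator_le_rootsOfUnityFixer`): a point of `E[p]` fixed by
`U` is `O`.  ROUTE-1 §15.1 (i) with `H = ρ̄(G_K)`. [cite: Serre1972, §5.2 (iv) and §5.4] -/
theorem geomTorsion_eq_zero_of_fixed_of_commutator_le (hp2 : p ≠ 2)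
    (hirr : W.HasIrreducibleModPGaloisRep p) {U : Subgroup (absoluteGaloisGroup ℚ)}
    (hU : commutator (absoluteGaloisGroup ℚ) ≤ U) (P : geomTorsion W p)
    (hP : ∀ σ ∈ U, σ • P = P) : P = 0 :=
  geomTorsion_eq_zero_of_commutator_fixed_of_irreducible W p hp2 hirr P fun σ hσ ↦ hP σ (hU hσ)

/-! ### `E(K)[p^∞] = 0` and "torsion over `K` has order prime to `p`" for `K ⊆ ℚ^{ab}` -/

/-- **`E(K)[p^∞] = 0` for `K ⊆ ℚ^{ab}`**: for `p` odd, `E[p]` irreducible, `U ≤ Γ_ℚ` containing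
the commutator subgroup, a geometric point `P ∈ E(\bar ℚ)` fixed by `U` with `p^k P = O` is `O`
(induction on `k`: `p^{k} P` ... `p^{k-1} P ∈ E[p]^U = 0`). [cite: Serre1972, §5.2 (iv) and §5.4] -/
theorem geomPoints_eq_zero_of_fixed_of_pow_smul_eq_zero (hp2 : p ≠ 2)
    (hirr : W.HasIrreducibleModPGaloisRep p) {U : Subgroup (absoluteGaloisGroup ℚ)}
    (hU : commutator (absoluteGaloisGroup ℚ) ≤ U) (P : geomPoints W)
    (hP : ∀ σ ∈ U, σ • P = P) (k : ℕ) (hk : p ^ k • P = 0) : P = 0 := by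
  induction k with
  | zero => rwa [pow_zero, one_smul] at hk
  | succ k ih =>
    apply ih
    -- `Q = p^k P ∈ E[p]` is fixed by `U`, hence `O`
    have hQp : p • (p ^ k • P) = 0 := by rw [smul_smul, ← pow_succ', hk]
    let Q : geomTorsion W p := ⟨p ^ k • P, AddSubgroup.torsionBy.nsmul_iff.mpr hQp⟩
    have hQ : ∀ σ ∈ U, σ • Q = Q := fun σ hσ ↦ Subtype.ext (by
      change σ • (p ^ k • P) = p ^ k • P
      rw [smul_comm, hP σ hσ])
    have hQ0 : Q = 0 := geomTorsion_eq_zero_of_fixed_of_commutator_le W p hp2 hirr hU Q hQ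
    exact congrArg Subtype.val hQ0

/-- **Torsion points over `K ⊆ ℚ^{ab}` have order prime to `p`**: for `p` odd, `E[p]`
irreducible, `U ≤ Γ_ℚ` containing the commutator subgroup, and a `U`-fixed geometric point `P` of
finite order `m`, `p ∤ m` (else `(m/p) P ∈ E[p]^U = 0` would have order `p`).  This is the form
consumed by F-d v2 (ii) (ROUTE-1 §15.1: "by (i) with `K = ℚ(ζ_N)` its order `m_r` is prime to `p`").
[cite: Serre1972, §5.2 (iv) and §5.4] -/
theorem not_dvd_addOrderOf_of_fixed (hp2 : p ≠ 2) (hirr : W.HasIrreducibleModPGaloisRep p)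
    {U : Subgroup (absoluteGaloisGroup ℚ)} (hU : commutator (absoluteGaloisGroup ℚ) ≤ U)
    (P : geomPoints W) (hP : ∀ σ ∈ U, σ • P = P) (hfin : IsOfFinAddOrder P) :
    ¬ p ∣ addOrderOf P := by
  intro hdvd
  have hpp : p.Prime := hp.out
  set m := addOrderOf P with hm
  have hm0 : 0 < m := hfin.addOrderOf_pos
  -- `Q = (m / p) P` lies in `E[p]` and is fixed by `U`
  have hQp : p • ((m / p) • P) = 0 := by
    rw [smul_smul, Nat.mul_div_cancel' hdvd, hm, addOrderOf_nsmul_eq_zero]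
  let Q : geomTorsion W p := ⟨(m / p) • P, AddSubgroup.torsionBy.nsmul_iff.mpr hQp⟩
  have hQ : ∀ σ ∈ U, σ • Q = Q := fun σ hσ ↦ Subtype.ext (by
    change σ • ((m / p) • P) = (m / p) • P
    rw [smul_comm, hP σ hσ])
  have hQ0 : (m / p) • P = 0 :=
    congrArg Subtype.val (geomTorsion_eq_zero_of_fixed_of_commutator_le W p hp2 hirr hU Q hQ)
  -- so `m ∣ m / p`, absurd
  have hdvd' : m ∣ m / p := by rw [hm]; exact addOrderOf_dvd_of_nsmul_eq_zero hQ0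
  have hpos : 0 < m / p := Nat.div_pos (Nat.le_of_dvd hm0 hdvd) hpp.pos
  have hle : m ≤ m / p := Nat.le_of_dvd hpos hdvd'
  have hlt : m / p < m := Nat.div_lt_self hm0 hpp.one_lt
  omega

/-! ### The cyclotomic case `K = ℚ(μ_N)` inside `\bar ℚ` -/

/-- **`E(ℚ(μ_N))[p^∞] = 0`** (`p` odd, `E[p]` irreducible, any `N ≥ 1`): a geometric point fixed by
`Gal(\bar ℚ/ℚ(μ_N)) = rootsOfUnityFixer ℚ N` and killed by a power of `p` is `O` — `ℚ(μ_N)/ℚ` is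
abelian (`commutator_le_rootsOfUnityFixer`).  (F-d v2 (ii): the cusps of `X₀(N)` are rational over
`ℚ(ζ_N)`, Stevens 1982 Thm 1.3.1 (a).) [cite: Serre1972, §5.2 (iv) and §5.4] -/
theorem geomPoints_eq_zero_of_rootsOfUnityFixer_fixed_of_pow_smul_eq_zero (hp2 : p ≠ 2)
    (hirr : W.HasIrreducibleModPGaloisRep p) (N : ℕ) [NeZero N] (P : geomPoints W)
    (hP : ∀ σ ∈ rootsOfUnityFixer ℚ N, σ • P = P) (k : ℕ) (hk : p ^ k • P = 0) : P = 0 :=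
  geomPoints_eq_zero_of_fixed_of_pow_smul_eq_zero W p hp2 hirr
    (commutator_le_rootsOfUnityFixer ℚ N) P hP k hk

/-- **Torsion points of `E` over `ℚ(μ_N)` have order prime to `p`** (`p` odd, `E[p]` irreducible).
[cite: Serre1972, §5.2 (iv) and §5.4] -/
theorem not_dvd_addOrderOf_of_rootsOfUnityFixer_fixed (hp2 : p ≠ 2)
    (hirr : W.HasIrreducibleModPGaloisRep p) (N : ℕ) [NeZero N] (P : geomPoints W)
    (hP : ∀ σ ∈ rootsOfUnityFixer ℚ N, σ • P = P) (hfin : IsOfFinAddOrder P) :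
    ¬ p ∣ addOrderOf P :=
  not_dvd_addOrderOf_of_fixed W p hp2 hirr (commutator_le_rootsOfUnityFixer ℚ N) P hP hfin

/-! ### Variants: `surj(p)`, and the row reading on class X4 -/

/-- **The `surj(p)` variant** (ROUTE-1 §15.4 R1-8 (i), second form): for `p` odd with
`ρ̄_{E,p}` surjective, a point of `E[p]` fixed by the commutator subgroup of `Γ_ℚ` is `O`
(surjective ⇒ irreducible, `hasIrreducibleModPGaloisRep_of_hasSurjectiveModNGaloisRep`; then the
kernel lemma).  Group-theoretically: `ρ̄([Γ,Γ]) = [GL₂(𝔽_p), GL₂(𝔽_p)] ⊇ SL₂(𝔽_p)` and the two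
elementary transvections have no common fixed vector (planner's finite core `route1/R18_core.lean`).
[cite: Serre1972, §5.2 (iv) and §5.4] -/
theorem geomTorsion_eq_zero_of_commutator_fixed_of_surj (hp2 : p ≠ 2)
    (hsurj : W.HasSurjectiveModNGaloisRep p) (P : geomTorsion W p)
    (hP : ∀ σ ∈ commutator (absoluteGaloisGroup ℚ), σ • P = P) : P = 0 := by
  haveI : NeZero p := ⟨hp.out.ne_zero⟩
  exact geomTorsion_eq_zero_of_commutator_fixed_of_irreducible W p hp2
    (hasIrreducibleModPGaloisRep_of_hasSurjectiveModNGaloisRep W p hsurj) P hP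

/-- **Row reading on class X4** (`ClassX4 W p = (p ≠ 2 ∧ add(p) ∧ irr(p))`, the N10/N11 rows):
on every X4 pair, `E[p]^{[Γ_ℚ,Γ_ℚ]} = 0` — the additive reduction type plays no role.
[cite: Serre1972, §5.2 (iv) and §5.4] -/
theorem geomTorsion_eq_zero_of_commutator_fixed_of_classX4 (hX4 : ClassX4 W p)
    (P : geomTorsion W p) (hP : ∀ σ ∈ commutator (absoluteGaloisGroup ℚ), σ • P = P) : P = 0 :=
  geomTorsion_eq_zero_of_commutator_fixed_of_irreducible W p hX4.1 hX4.2.2 P hP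

/-- **Row reading on class X4, torsion-order form**: on an X4 pair `(E, p)`, a torsion point of `E`
over any `K ⊆ ℚ^{ab}` (`U = Γ_K ⊇ [Γ_ℚ, Γ_ℚ]`) has order prime to `p`.
[cite: Serre1972, §5.2 (iv) and §5.4] -/
theorem not_dvd_addOrderOf_of_fixed_of_classX4 (hX4 : ClassX4 W p)
    {U : Subgroup (absoluteGaloisGroup ℚ)} (hU : commutator (absoluteGaloisGroup ℚ) ≤ U)
    (P : geomPoints W) (hP : ∀ σ ∈ U, σ • P = P) (hfin : IsOfFinAddOrder P) :
    ¬ p ∣ addOrderOf P :=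
  not_dvd_addOrderOf_of_fixed W p hX4.1 hX4.2.2 hU P hP hfin

end Summit.BirchSwinnertonDyer.Rank1Residual.GaloisImage

end
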